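/- Copyright: the b2b-balaban cell (near-miss cell 7), T⁴-continuum fan-out, lineage t4-ne7b-p1 (row NE7b OWNER + CRUX
PROVER NE7b), gen 45: (α)-M5-3c «THE CREDIT PLUG» on the pass-V objects.  Released under the licence of the surrounding
project. -/
import Summits.QuantumFields.BalabanUV.T4Continuum.Support.HistoryBankingCreditRead
import Summits.QuantumFields.BalabanUV.T4Continuum.Support.HistoryBankingForestPlug

/-!
# History banking, M5-3c: THE CREDIT READING ON THE PASS-V OBJECTS — a live dissolved component's LIVE FACTOR in the
END's price currency: `e^{lifeCost (costT)}·e^{birthWT}·evProd ≤ pshapeTH … (costT) · e^{birthWT} · e^{−Ξ}` (re-open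
object (α) of row NE7b, `SCOPE-alpha.md` §5 row M5, part M5-3; ruling R-OWNER-45-1, owner gen 45)

Summits-side support leaf of the T⁴-continuum cell (rung (B)+1 on a FINITE torus only; NOT infinite volume, NOT the
mass gap, NOT the Clay statement; NOT a proof of the spine estimate NE7b — the cell's OWN estimate, NOT PRINTED, NOT
PROVED).  [folklore] composition BY NAME of the owner's M5-3a∕b (`HistoryBankingDiscountCharge.RoundingRoom`,
`HistoryBankingCreditRead.{FactorRead, evProd_toPGen_le_genT}`) with the pass-V junction's timing kit as assembled in
M5-2 (`HistoryBankingForestPlug.{wf_genT_pedMV, lastStep_toPGen_pedMV_le}`, `HistoryRealiseWeak.consistentTLE_genT_of_realisesW`,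
`HistoryGenealogyInstantiate.RunInputM.{pedMV, histV, realisesW_pedMV, renew_step_pedMV}`) and the price letter
`HistoryConstantsTH.pshapeTH`; no definition, no `[cite:]` tag, nothing printed asserted, no `Prop` fact minted, zero
`sorry`.

WHY.  M2 brick B × M5-2 (`B16HistoryWeightPlug.weight_le_live_mul_dead`) bounds a (1.72) term's weight by
`LIVE · DEAD · rest` with, per live dissolved component `x ∈ histV.comp K`, the live factor
`e^{lifeCost (dictWT Prod.fst R C.n₁) (costT Prod.fst C K R) (pedMV.genT (K, x))} · e^{birthWT Prod.fst (2^{d+3}·log Λ K) (pedMV.genT (K, x))} ·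
evProd (fB K) (fR K) (pedMV.toPGen id (K, x))`; the `κ := costT` price sentence `priceM` of the V-witness with the class
remainder displayed (`HistoryRealiseCellsRunApexT3bWTVS`, IR-44-1 (3)) asks, per live member, `pshapeTH Prod.fst O C 1 1 (R K) g
0 (costT …) q.2 · e^{birthWT Prod.fst (uV K) q.2} · e^{−(8∕E₂·totalCostT … q.2 + 4·partnerAges … q.2)}`.  THIS FILE closes
the gap between the two PER LIVE MEMBER, modulo the two R-class displays of M5-3 (`FactorRead`, `RoundingRoom`) and the
run's (2.9): §1 the live dissolved component's tagged genealogy is `ConsistentTLE` (named here; the ingredients are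
M5-2's); §2 **`evProd_pedMV_le`** — the credit reading on `pedMV`; §3 **`liveFactor_pedMV_le`** — the live factor IS
below the price sentence's per-member right-hand side (`pshapeTH` at `Δ = Λ′ = 1`, `D = 0` unfolds to
`e^{−credits (pcredit ∘ Prod.fst)}·e^{+lifeCost (costT)}` by `padW_zero`); §4 **`prod_liveFactor_pedMV_le`** — the
product over the live dissolved components.  The identification of the product's index set with the END's `memOf`
members (`q.2 = pedMV.genT (K, x)`) and the witness fields `FcM`∕`RfM` are the S12-W crew's witness construction
(INTERFACE REQUEST IR-45-1); the dead factors ride with `dead`∕`resumM`.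

HONEST SCOPE.  Bookkeeping; hypotheses = the pass-V process conditions of M4∕M5-2 VERBATIM (`NewOK`, `Rm ≤ R`, its
one-step form, `2 ≤ Rm t 1`, `NewDisjoint`, `0 < L`, `4 ≤ L` with drop control, `R ≥ 1`, `13 ≤ n₁`) + the two displays
+ (2.9) (`B14FlowStep.FlowIneq29`) + `E₂ > 0`, `E₃ ≥ 0`; nothing of H3 ∕ (B) ∕ BetaPertH discharged.  BY-NAME EFFECT ON THE
WALL (with M5-3a∕b): `priceM`'s CREDIT part is kernel modulo `FactorRead` ∕ `RoundingRoom` (WALL-NE7b-P1 v1.19); `resumM`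
and the reading `realised`∕`reprA∕reprB` unchanged.  NE7b NOT proved; spine 0∕9.  HONEST DEPENDENCY (cell): continuum YM
on T⁴ ⇐ BetaPertH ∧ nine spine estimates (0/9 proved); BetaPertH ⇐ (D1) ∧ (D4) ∧ CAP+tail; G-an2-4 gates asym, D1 and
NE2/3/4.  This file changes none of it.
-/

open Finset
open Literature.MathematicalPhysics.QuantumFieldTheory.Balaban1983to89
open Literature.MathematicalPhysics.QuantumFieldTheory.Balaban1983to89.B13ScaleTransfer
open Literature.MathematicalPhysics.QuantumFieldTheory.Balaban1983to89.B16SProfile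
open T4PersistenceDictionary T4PrintedShapeBanking T4TaggedShapeBanking T4BankedInduction T4PartnerMultiplicity
open Summit.QuantumFields.BalabanUV.T4Continuum.HistoryAdmissible
open Summit.QuantumFields.BalabanUV.T4Continuum.HistoryRealise
open Summit.QuantumFields.BalabanUV.T4Continuum.HistoryRealisePrint
open Summit.QuantumFields.BalabanUV.T4Continuum.HistoryRealiseWeak
open Summit.QuantumFields.BalabanUV.T4Continuum.HistoryGen
open Summit.QuantumFields.BalabanUV.T4Continuum.HistoryGenealogyExtraction
open Summit.QuantumFields.BalabanUV.T4Continuum.HistoryGenealogyPedigree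
open Summit.QuantumFields.BalabanUV.T4Continuum.HistoryGenealogyInstantiate
open Summit.QuantumFields.BalabanUV.T4Continuum.HistoryBankingLE
open Summit.QuantumFields.BalabanUV.T4Continuum.LateMergers (padW padW_zero)
open Summit.QuantumFields.BalabanUV.T4Continuum.HistoryConstants
open Summit.QuantumFields.BalabanUV.T4Continuum.HistoryBankingVolumePlug
open Summit.QuantumFields.BalabanUV.T4Continuum.HistoryBankingForestPlug
open Summit.QuantumFields.BalabanUV.T4Continuum.HistoryBankingDiscountCharge
open Summit.QuantumFields.BalabanUV.T4Continuum.HistoryBankingCreditRead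

namespace Summit.QuantumFields.BalabanUV.T4Continuum.HistoryBankingCreditPlug

noncomputable section

-- the structural `DecidableEq` instance of the concrete tag type `Lab (ℕ × Lab d) (Lab d)` exceeds the default
-- synthesis size (`synthInstance.maxSize` 128 — a classical fallback would not match the generic lemmas' instances)
set_option synthInstance.maxSize 1024

variable {d : ℕ} {I : RunInputM d} {C : T4PrintedShapeBanking.Consts} {O : PrintedO1s} {L : ℕ} {g : ℕ → ℝ}
  {β' β₀ : ℝ} {fB : ℕ → ℕ → Pt d × Finset (Pt d) → ℝ} {fR : ℕ → ℝ} {sB : ℕ → ℕ → ℝ} {sR : ℕ → ℝ}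

/-! ## §1 A live dissolved component's tagged genealogy is `ConsistentTLE` -/

/-- **THE TAGGED GENEALOGY OF A LIVE DISSOLVED COMPONENT IS `ConsistentTLE` AT THE CUTOFF** (shape `Prod.fst`; from the
weak realisation of `pedMV` and pendency before `K` — M5-2's ingredients, named). [folklore] -/
theorem consistentTLE_genT_pedMV (hN : I.NewOK) (hRm : ∀ t k, I.Rm t k ≤ I.R t)
    (hRmS : ∀ t k, I.Rm t (k + 1) ≤ I.R (t + 1)) (hRm2 : ∀ t, 2 ≤ I.Rm t 1) (hD : I.NewDisjoint) (hL : 0 < I.L)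
    (hL4 : 4 ≤ I.L) (hdrop : ∀ m, DropCtl I.s m) (hR : ∀ t, 1 ≤ I.R t) (hn₁ : 13 ≤ C.n₁) {K : ℕ}
    {c : Pt d × Finset (Pt d)} (hc : c ∈ I.histV.comp K) : ConsistentTLE Prod.fst C K I.R (I.pedMV.genT (K, c)) :=
  consistentTLE_genT_of_realisesW hL4 hdrop hR C hn₁ I.pedMV id RunInputM.renew_step_pedMV
    (RunInputM.realisesW_pedMV hN hRm hRmS hRm2 hD hL hc) (lastStep_toPGen_pedMV_le hN hRm hRmS hRm2 hD hL hc)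

/-! ## §2 The credit reading on `pedMV` -/

/-- **THE CREDIT READING OF A LIVE DISSOLVED COMPONENT**: under the displays `FactorRead fB fR sB sR` (event-wise sharp
factor readings) and `RoundingRoom C O L K I.R g sB sR` (print's two roundings read with room), (2.9) on the run's sizes,
`L ≥ 1`, `E₂ > 0`, `E₃ ≥ 0`, and the pass-V process conditions:
`evProd fB fR (pedMV.toPGen id (K, c)) ≤ exp (−credits (pcredit O C g ∘ Prod.fst) (pedMV.genT (K, c))) · exp (−(8∕E₂·totalCostT
Prod.fst C K I.R (pedMV.genT (K, c)) + 4·partnerAges (PEv.step ∘ Prod.fst) (pedMV.genT (K, c))))`. [folklore] -/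
theorem evProd_pedMV_le (hN : I.NewOK) (hRm : ∀ t k, I.Rm t k ≤ I.R t) (hRmS : ∀ t k, I.Rm t (k + 1) ≤ I.R (t + 1))
    (hRm2 : ∀ t, 2 ≤ I.Rm t 1) (hD : I.NewDisjoint) (hL : 0 < I.L) (hL4 : 4 ≤ I.L) (hdrop : ∀ m, DropCtl I.s m)
    (hR : ∀ t, 1 ≤ I.R t) (hn₁ : 13 ≤ C.n₁) (hE₂ : 0 < C.E₂) (hE₃ : 0 ≤ C.E₃) {K : ℕ} (hF : FactorRead fB fR sB sR)
    (hRR : RoundingRoom C O L K I.R g sB sR) (h29 : B14FlowStep.FlowIneq29 I.R g L β' β₀ K) (hL1 : 1 ≤ L)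
    {c : Pt d × Finset (Pt d)} (hc : c ∈ I.histV.comp K) :
    evProd fB fR (I.pedMV.toPGen id (K, c)) ≤
      Real.exp (-credits (pcredit O C g ∘ Prod.fst) (I.pedMV.genT (K, c))) *
        Real.exp (-(8 / C.E₂ * totalCostT Prod.fst C K I.R (I.pedMV.genT (K, c)) +
          4 * (partnerAges (PEv.step ∘ Prod.fst) (I.pedMV.genT (K, c)) : ℝ))) :=
  evProd_toPGen_le_genT hF hRR h29 hL1 hE₂ hE₃ I.pedMV id RunInputM.renew_step_pedMV (K, c)
    (wf_genT_pedMV hN hRm hRmS hRm2 hD hL hL4 hdrop hR hn₁ hc)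
    (consistentTLE_genT_pedMV hN hRm hRmS hRm2 hD hL hL4 hdrop hR hn₁ hc)

/-! ## §3 The live factor in the END's price currency -/

/-- `pshapeTH` at `Δ = Λ′ = 1`, `D = 0` is print's credit prefactor times the booked life cost (`padW_zero`). [folklore] -/
theorem pshapeTH_one_one_zero {ε : Type*} [DecidableEq ε] (sh : ε → PEv) (O : PrintedO1s) (C : T4PrintedShapeBanking.Consts)
    (R : ℕ → ℕ) (g : ℕ → ℝ) (κ : Gen ε → ℕ → ℝ) (G : Gen ε) :
    pshapeTH sh O C 1 1 R g 0 κ G =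
      Real.exp (-credits (pcredit O C g ∘ sh) G) * Real.exp (lifeCost (dictWT sh R C.n₁) κ G) := by
  rw [pshapeTH, padW_zero, one_pow, one_mul, one_mul]

/-- **THE LIVE FACTOR OF A LIVE DISSOLVED COMPONENT IS BELOW THE PRICE SENTENCE's PER-MEMBER RIGHT-HAND SIDE**: for any
weight `uV` of the class remainder,
`e^{lifeCost (dictWT Prod.fst I.R C.n₁) (costT Prod.fst C K I.R) G} · e^{birthWT Prod.fst uV G} · evProd fB fR (pedMV.toPGen id (K, c))
  ≤ pshapeTH Prod.fst O C 1 1 I.R g 0 (costT Prod.fst C K I.R) G · e^{birthWT Prod.fst uV G} · e^{−(8∕E₂·totalCostT … G + 4·partnerAges … G)}`,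
`G = pedMV.genT (K, c)` — the shape of `HistoryRealiseCellsRunApexT3bWTVS.CountRoadWitnessT3bWTVS.priceM` per live member.
[folklore] -/
theorem liveFactor_pedMV_le (hN : I.NewOK) (hRm : ∀ t k, I.Rm t k ≤ I.R t) (hRmS : ∀ t k, I.Rm t (k + 1) ≤ I.R (t + 1))
    (hRm2 : ∀ t, 2 ≤ I.Rm t 1) (hD : I.NewDisjoint) (hL : 0 < I.L) (hL4 : 4 ≤ I.L) (hdrop : ∀ m, DropCtl I.s m)
    (hR : ∀ t, 1 ≤ I.R t) (hn₁ : 13 ≤ C.n₁) (hE₂ : 0 < C.E₂) (hE₃ : 0 ≤ C.E₃) {K : ℕ} (hF : FactorRead fB fR sB sR)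
    (hRR : RoundingRoom C O L K I.R g sB sR) (h29 : B14FlowStep.FlowIneq29 I.R g L β' β₀ K) (hL1 : 1 ≤ L)
    (uV : ℕ → ℝ) {c : Pt d × Finset (Pt d)} (hc : c ∈ I.histV.comp K) :
    Real.exp (lifeCost (dictWT Prod.fst I.R C.n₁) (costT Prod.fst C K I.R) (I.pedMV.genT (K, c))) *
        Real.exp (birthWT Prod.fst uV (I.pedMV.genT (K, c))) * evProd fB fR (I.pedMV.toPGen id (K, c)) ≤
      pshapeTH Prod.fst O C 1 1 I.R g 0 (costT Prod.fst C K I.R) (I.pedMV.genT (K, c)) *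
        Real.exp (birthWT Prod.fst uV (I.pedMV.genT (K, c))) *
        Real.exp (-(8 / C.E₂ * totalCostT Prod.fst C K I.R (I.pedMV.genT (K, c)) +
          4 * (partnerAges (PEv.step ∘ Prod.fst) (I.pedMV.genT (K, c)) : ℝ))) := by
  have key := evProd_pedMV_le hN hRm hRmS hRm2 hD hL hL4 hdrop hR hn₁ hE₂ hE₃ hF hRR h29 hL1 (O := O) hc
  have h0 : 0 ≤ Real.exp (lifeCost (dictWT Prod.fst I.R C.n₁) (costT Prod.fst C K I.R) (I.pedMV.genT (K, c))) *
      Real.exp (birthWT Prod.fst uV (I.pedMV.genT (K, c))) := mul_nonneg (Real.exp_pos _).le (Real.exp_pos _).le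
  rw [pshapeTH_one_one_zero]
  calc _ ≤ Real.exp (lifeCost (dictWT Prod.fst I.R C.n₁) (costT Prod.fst C K I.R) (I.pedMV.genT (K, c))) *
        Real.exp (birthWT Prod.fst uV (I.pedMV.genT (K, c))) *
        (Real.exp (-credits (pcredit O C g ∘ Prod.fst) (I.pedMV.genT (K, c))) *
          Real.exp (-(8 / C.E₂ * totalCostT Prod.fst C K I.R (I.pedMV.genT (K, c)) +
            4 * (partnerAges (PEv.step ∘ Prod.fst) (I.pedMV.genT (K, c)) : ℝ)))) :=
        mul_le_mul_of_nonneg_left key h0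
    _ = _ := by ring

/-- the live factor is nonnegative (factors `≥ 0` by `FactorRead`) [folklore] -/
theorem liveFactor_nonneg (hF : FactorRead fB fR sB sR) (R : ℕ → ℕ) (K : ℕ) (uV : ℕ → ℝ) (x : ℕ × (Pt d × Finset (Pt d))) :
    0 ≤ Real.exp (lifeCost (dictWT Prod.fst R C.n₁) (costT Prod.fst C K R) (I.pedMV.genT x)) *
      Real.exp (birthWT Prod.fst uV (I.pedMV.genT x)) * evProd fB fR (I.pedMV.toPGen id x) :=
  mul_nonneg (mul_nonneg (Real.exp_pos _).le (Real.exp_pos _).le) (evProd_nonneg hF.fB_nonneg hF.fR_nonneg _)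

/-! ## §4 The product over the live dissolved components -/

/-- **THE LIVE PART OF A TERM's WEIGHT IS BELOW THE PRODUCT OF THE PRICE SENTENCE's RIGHT-HAND SIDES** over the live
dissolved components at the cutoff (the `LIVE` factor of `B16HistoryWeightPlug.weight_le_live_mul_dead` with the class
remainder weight `uV`, e.g. `uV = 2^{d+3}·log Λ K`):
`∏_{x ∈ histV.comp K} e^{lifeCost …}·e^{birthWT … uV …}·evProd … ≤ ∏_{x ∈ histV.comp K} pshapeTH … (costT …) (pedMV.genT (K, x)) ·
e^{birthWT Prod.fst uV (pedMV.genT (K, x))} · e^{−Ξ K (pedMV.genT (K, x))}`. [folklore] -/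
theorem prod_liveFactor_pedMV_le (hN : I.NewOK) (hRm : ∀ t k, I.Rm t k ≤ I.R t)
    (hRmS : ∀ t k, I.Rm t (k + 1) ≤ I.R (t + 1)) (hRm2 : ∀ t, 2 ≤ I.Rm t 1) (hD : I.NewDisjoint) (hL : 0 < I.L)
    (hL4 : 4 ≤ I.L) (hdrop : ∀ m, DropCtl I.s m) (hR : ∀ t, 1 ≤ I.R t) (hn₁ : 13 ≤ C.n₁) (hE₂ : 0 < C.E₂)
    (hE₃ : 0 ≤ C.E₃) {K : ℕ} (hF : FactorRead fB fR sB sR) (hRR : RoundingRoom C O L K I.R g sB sR)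
    (h29 : B14FlowStep.FlowIneq29 I.R g L β' β₀ K) (hL1 : 1 ≤ L) (uV : ℕ → ℝ) :
    ∏ x ∈ I.histV.comp K,
        Real.exp (lifeCost (dictWT Prod.fst I.R C.n₁) (costT Prod.fst C K I.R) (I.pedMV.genT (K, x))) *
          Real.exp (birthWT Prod.fst uV (I.pedMV.genT (K, x))) * evProd fB fR (I.pedMV.toPGen id (K, x)) ≤
      ∏ x ∈ I.histV.comp K,
        pshapeTH Prod.fst O C 1 1 I.R g 0 (costT Prod.fst C K I.R) (I.pedMV.genT (K, x)) *
          Real.exp (birthWT Prod.fst uV (I.pedMV.genT (K, x))) *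
          Real.exp (-(8 / C.E₂ * totalCostT Prod.fst C K I.R (I.pedMV.genT (K, x)) +
            4 * (partnerAges (PEv.step ∘ Prod.fst) (I.pedMV.genT (K, x)) : ℝ))) :=
  Finset.prod_le_prod (fun x _ => liveFactor_nonneg hF I.R K uV (K, x)) fun _ hx =>
    liveFactor_pedMV_le hN hRm hRmS hRm2 hD hL hL4 hdrop hR hn₁ hE₂ hE₃ hF hRR h29 hL1 uV hx

end

end Summit.QuantumFields.BalabanUV.T4Continuum.HistoryBankingCreditPlug
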